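import Mathlib
import HarnessLib
import Summits.HubbardSuperconductivity.HubbardSuperconductivity.Theorems.KLProgrammeH10TwoPointLimitSectorMultiplierDiffs
import Summits.HubbardSuperconductivity.HubbardSuperconductivity.Theorems.KLProgrammeH10TwoPointLimitSymbolCellGeometry

/-!
# Route `KLProgramme` — engine support, route (L2): the SUPPORT COUNT of the two-multiplier symbol of `klAnisoFamily` pairs on an
# admissible frame (time window × rotated box: the `√Λ` saving), and the nearly TANGENT integer step at the cell's Fermi point

Cell `gate-hubbard-kl`, seat p4 (C5a lead), g6; HOME/prover-p4/FRAME-L22-NOTE.md §3″ (d).  The two remaining inputs of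
`sum_norm_charSum_le_of_second_differences` for the overlap size `B` (BGM 2006 (2.71a)) after `…SectorMultiplierDiffs`:
* **`card_support_klAnisoPair_le`** — `#{q : F_{ω₁}F_{ω₂}(k(q)) ≠ 0} ≤ (Λ_{n₁}β/π + 1)·(√2L(Λ_{n₁} + (4+4A)ρ²)/(γπ) + 2)(2√2Lρ/π + 2)`,
  `γ = 2ρ_min − 4A` (`gradient_floor_klFermiPoint`), `ρ` the cell radius — phase space `βL²·Λ·ρ`, i.e. `O(βL²γ^{h}γ^{h/2})`;
* **`tangentStep_bounds`** — for the integer rounding `v` of `N·τ̂`, `τ̂ = (−g₁, g₀)/|g|` the unit tangent of the frame's curve at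
  `p_F = klFermiPoint μ K θ_{n₂,ω₂}` (`g` the gradient pair of `e_K ∘ toLp` at `p_F`): `|De_K(p_F)(hₓv)| ≤ |hₓ|(4 + 2A)` (the first-order
  term of the tangential line derivative does NOT grow with `N`), `|v_j| ≤ N + ½`, and `v ≠ 0` for `N ≥ 1`.
Everything is proved; no definitions, no named facts. [folklore]
-/

noncomputable section

namespace Summit.HubbardSuperconductivity.HubbardSuperconductivity.Theorems.TorusFourierL2

set_option linter.dupNamespace false -- summit = problem name (single-conjunct summit), D-0017

open Set Finset Literature.MathematicalPhysics.QuantumLattice Literature.MathematicalPhysics.QuantumLattice.BandSectorCounting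
open Literature.MathematicalPhysics.QuantumLattice.FermiRG Literature.Probability.LatticeModels Literature.Analysis.SpecialFunctions
open Summit.HubbardSuperconductivity.HubbardSuperconductivity.Theorems.DispersionFlow
open Summit.HubbardSuperconductivity.HubbardSuperconductivity.Theorems.KLRegimeSplit
open Summit.HubbardSuperconductivity.HubbardSuperconductivity.Theorems.KLProgrammeLegKernels
open Summit.HubbardSuperconductivity.HubbardSuperconductivity.Theorems.PerturbedFermiCurve
open scoped Real

section Support

variable {L M : ℕ} [NeZero L] [NeZero M] {a b : ℝ} (B : BandBounds a b) {K : TrigPolyC4v} {A : ℝ}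
  (hA : ∀ p : Momentum, ∀ j ≤ 2, ‖iteratedFDeriv ℝ j (frameShift K) p‖ ≤ A) (hADt : 2 * A < B.Dtmin)
  {μ e₀ z β : ℝ} (he : 0 < e₀) (hz : 0 < z) (hz1 : z ≤ 1) (hgap : e₀ + A + z ^ 2 < -μ) (h3 : e₀ + A - μ ≤ 3)
  (hlo : a ≤ μ - A - e₀) (hhi : μ + A + e₀ ≤ b) (hβ : 0 < β) (hρA : 4 * A < 2 * B.rhomin)
  {n₁ n₂ : ℕ} (hn : n₂ ≤ n₁) (ω₁ : Fin (sectorCount n₁)) (ω₂ : Fin (sectorCount n₂))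
  {d : ℝ} (hd : 0 ≤ d) (hd1 : ∀ u, |deriv (bgmCutoffSq e₀) u| ≤ d) (hd2 : ∀ u, |iteratedDeriv 2 (bgmCutoffSq e₀) u| ≤ d)
  {Z : (Fin 2 → ℝ) → ℝ}
  (hZ : ∀ p, Z p = gnCutoff ((π + z) ^ 2 / π ^ 2) ((π + z) ^ 2) (p 0 ^ 2) * gnCutoff ((π + z) ^ 2 / π ^ 2) ((π + z) ^ 2) (p 1 ^ 2) *
    ((radialCutoffC (1 / 2) (momToComplex p) * sectorWeightCirc n₁ ((ω₁ : ℕ) : ℤ) (polarAngle p)) *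
      (radialCutoffC (1 / 2) (momToComplex p) * sectorWeightCirc n₂ ((ω₂ : ℕ) : ℤ) (polarAngle p))))
  {Φ : ℝ × (Fin 2 → ℝ) → ℂ}
  (hΦ : ∀ k₀ p, Φ (k₀, p) = ((bgmCutoffSq e₀ ((16 : ℝ) ^ n₁ * (k₀ ^ 2 + frameLevel μ K (WithLp.toLp 2 p) ^ 2)) *
      bgmCutoffSq e₀ ((16 : ℝ) ^ n₂ * (k₀ ^ 2 + frameLevel μ K (WithLp.toLp 2 p) ^ 2)) * Z p : ℝ) : ℂ))
  {Gs : TorusSite 1 (2 * M) × TorusSite 2 L → ℂ}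
  (hGs : ∀ q, Gs q = klAnisoFamily L M β μ K e₀ n₁ ω₁ (⟨(q.1 0).val, ZMod.val_lt (q.1 0)⟩, q.2) *
    klAnisoFamily L M β μ K e₀ n₂ ω₂ (⟨(q.1 0).val, ZMod.val_lt (q.1 0)⟩, q.2))

include B hA hADt he hz hz1 hgap h3 hlo hhi hβ hρA hn hd hd1 hd2 hZ hΦ hGs in
/-- **Support count of the two-multiplier symbol**: time window × rotated box,
`#{G̃ ≠ 0} ≤ (Λ_{n₁}β/π + 1)·(√2 L (Λ_{n₁} + (4+4A)ρ²)/(γπ) + 2)(√2 L (2ρ)/π + 2)`, `γ = 2ρ_min − 4A`,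
`ρ = (Λ_{n₁} + s_max Dt_min (3w_{n₂}/4))/(Dt_min − 2A)`. [cite: BenfattoGiulianiMastropietro2006, §2.5 (2.46)–(2.50)] -/
theorem card_support_klAnisoPair_le [DecidablePred fun q : TorusSite 1 (2 * M) × TorusSite 2 L => Gs q ≠ 0] :
    (((univ : Finset (TorusSite 1 (2 * M) × TorusSite 2 L)).filter fun q => Gs q ≠ 0).card : ℝ) ≤
      (klScale e₀ n₁ * β / π + 1) *
        ((Real.sqrt 2 * L * ((klScale e₀ n₁ + (4 + 4 * A) *
            ((klScale e₀ n₁ + B.smax * B.Dtmin * (3 * sectorWidth n₂ / 4)) / (B.Dtmin - 2 * A)) ^ 2) / (2 * B.rhomin - 4 * A)) / π + 2) *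
          (Real.sqrt 2 * L * (2 * ((klScale e₀ n₁ + B.smax * B.Dtmin * (3 * sectorWidth n₂ / 4)) / (B.Dtmin - 2 * A))) / π + 2)) := by
  classical
  obtain ⟨-, -, -, -, hGv⟩ := scaleProfile_mul_bounds he hn hd hd1 hd2
  have hΛ : 0 < klScale e₀ n₁ := by rw [klScale]; positivity
  have hL : (0 : ℝ) < L := Nat.cast_pos.2 (Nat.pos_of_ne_zero (NeZero.ne L))
  have hπ := Real.pi_pos
  have hxL : |2 * π / (L : ℝ)| * L = 2 * π := by rw [abs_of_pos (by positivity)]; field_simp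
  set ρ : ℝ := (klScale e₀ n₁ + B.smax * B.Dtmin * (3 * sectorWidth n₂ / 4)) / (B.Dtmin - 2 * A) with hρdef
  have hρ0 : 0 ≤ ρ := by
    have := B.smax_pos; have := B.Dtmin_pos; have := sectorWidth_pos n₂
    have : 0 < B.Dtmin - 2 * A := by linarith
    positivity
  set pF : Fin 2 → ℝ := klFermiPoint μ K (sectorCenter n₂ (ω₂ : ℕ)) with hpF
  set eK : (Fin 2 → ℝ) → ℝ := fun p => frameLevel μ K (WithLp.toLp 2 p) with heK
  have hcount := card_support_sampledSymbol_le (P := 2 * M) (L := L) hΛ hGv eK Z (pF := pF) (ρ := ρ) hz.le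
    (fun p hsq hshell hZp => symbol_cell B hA hADt he hz hz1 hgap hlo hhi ω₁ ω₂ hZ p hsq hshell hZp)
    Φ (fun k₀ p => hΦ k₀ p) (π * (1 - 2 * M) / β) (2 * π / β) (2 * π / L) hxL Gs
    (klAnisoPair_eq_sample hA he hz h3 ω₁ ω₂ hZ hΦ hGs)
  -- the two factors
  have hT : (((univ : Finset (TorusSite 1 (2 * M))).filter fun i =>
      |π * (1 - 2 * M) / β + 2 * π / β * (((i 0).val : ℕ) : ℝ)| ≤ klScale e₀ n₁).card : ℝ) ≤ klScale e₀ n₁ * β / π + 1 := by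
    have h := card_filter_timeWindow_le (P := 2 * M) (a₀ := π * (1 - 2 * M) / β) (h₀ := 2 * π / β) (Λ := klScale e₀ n₁)
      (by positivity) hΛ.le
    refine h.trans (le_of_eq ?_)
    field_simp
  have hlo' : a ≤ μ - A := by linarith
  have hhi' : μ + A ≤ b := by linarith
  have hγ : 0 < 2 * B.rhomin - 4 * A := by linarith
  have hX : (((univ : Finset (TorusSite 2 L)).filter fun k =>
      |eK (fun j => 2 * π / L * (((k j).valMinAbs : ℤ) : ℝ))| ≤ klScale e₀ n₁ ∧
        ‖(fun j => 2 * π / L * (((k j).valMinAbs : ℤ) : ℝ)) - pF‖ ≤ ρ).card : ℝ) ≤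
      (Real.sqrt 2 * L * ((klScale e₀ n₁ + (4 + 4 * A) * ρ ^ 2) / (2 * B.rhomin - 4 * A)) / π + 2) *
        (Real.sqrt 2 * L * (2 * ρ) / π + 2) := by
    refine card_filter_cell_le L (contDiff_frameBand μ K) (norm_iteratedFDeriv_two_frameBand_le hA μ)
      (pF := pF) (frameLevel_klFermiPoint B hA hlo' hhi' (sectorCenter n₂ (ω₂ : ℕ))) hΛ.le hρ0 hγ
      (gradient_floor_klFermiPoint B hA hlo' hhi' (sectorCenter n₂ (ω₂ : ℕ))) _ ?_
    intro k hk
    obtain ⟨h1, h2⟩ := (Finset.mem_filter.1 hk).2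
    have e : (fun j => 2 * π * (((k j).valMinAbs : ℤ) : ℝ) / L) = fun j => 2 * π / L * (((k j).valMinAbs : ℤ) : ℝ) :=
      funext fun j => by ring
    rw [e]; exact ⟨h1, h2⟩
  calc _ ≤ ((((univ : Finset (TorusSite 1 (2 * M))).filter fun i =>
        |π * (1 - 2 * M) / β + 2 * π / β * (((i 0).val : ℕ) : ℝ)| ≤ klScale e₀ n₁).card *
        ((univ : Finset (TorusSite 2 L)).filter fun k =>
          |eK (fun j => 2 * π / L * (((k j).valMinAbs : ℤ) : ℝ))| ≤ klScale e₀ n₁ ∧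
            ‖(fun j => 2 * π / L * (((k j).valMinAbs : ℤ) : ℝ)) - pF‖ ≤ ρ).card : ℕ) : ℝ) := by exact_mod_cast hcount
    _ ≤ _ := by
        push_cast
        exact mul_le_mul hT hX (Nat.cast_nonneg _) (by positivity)

end Support

/-! ### The nearly tangent integer step -/

/-- **The integer rounding of `N·τ̂` is nearly tangent, nonzero and of size `≤ N + ½`.**  For a `C¹` function `e` on `Fin 2 → ℝ` with
`‖De(p_F)‖ ≤ G₁` and gradient pair `g = (De(p_F)e₀, De(p_F)e₁)` of length `|g| > 0`, the unit tangent `τ̂ = (−g₁, g₀)/|g|` and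
`v_j = round(N τ̂_j)`: `|De(p_F)(hₓ v)| ≤ |hₓ|·G₁` (independent of `N`), `|v_j| ≤ N + ½`, and `v ≠ 0` when `N ≥ 1`. [folklore] -/
theorem tangentStep_bounds (e : (Fin 2 → ℝ) → ℝ) (pF : Fin 2 → ℝ) {G₁ : ℝ} (hG : ‖fderiv ℝ e pF‖ ≤ G₁)
    (hN0 : 0 < Real.sqrt (fderiv ℝ e pF (Pi.single 0 1) ^ 2 + fderiv ℝ e pF (Pi.single 1 1) ^ 2)) {N : ℝ} (hN : 1 ≤ N)
    (v : Fin 2 → ℤ)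
    (hv0 : v 0 = round (N * (-fderiv ℝ e pF (Pi.single 1 1) /
      Real.sqrt (fderiv ℝ e pF (Pi.single 0 1) ^ 2 + fderiv ℝ e pF (Pi.single 1 1) ^ 2))))
    (hv1 : v 1 = round (N * (fderiv ℝ e pF (Pi.single 0 1) /
      Real.sqrt (fderiv ℝ e pF (Pi.single 0 1) ^ 2 + fderiv ℝ e pF (Pi.single 1 1) ^ 2))))
    (hx : ℝ) :
    |fderiv ℝ e pF (fun j => hx * (v j : ℝ))| ≤ |hx| * G₁ ∧ (∀ j, |(v j : ℝ)| ≤ N + 1 / 2) ∧ v ≠ 0 := by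
  set g₀ := fderiv ℝ e pF (Pi.single 0 1) with hg₀
  set g₁ := fderiv ℝ e pF (Pi.single 1 1) with hg₁
  set Ng := Real.sqrt (g₀ ^ 2 + g₁ ^ 2) with hNg
  have hNsq : Ng ^ 2 = g₀ ^ 2 + g₁ ^ 2 := Real.sq_sqrt (by positivity)
  -- sizes of the gradient pair
  have hgi : ∀ i : Fin 2, |fderiv ℝ e pF (Pi.single i 1)| ≤ G₁ := fun i => by
    rw [← Real.norm_eq_abs]
    refine ((fderiv ℝ e pF).le_opNorm _).trans ?_
    rw [Pi.norm_single, norm_one, mul_one]; exact hG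
  have hG0 : 0 ≤ G₁ := (abs_nonneg _).trans (hgi 0)
  -- the rounding errors
  set δ₀ : ℝ := (v 0 : ℝ) - N * (-g₁ / Ng) with hδ₀
  set δ₁ : ℝ := (v 1 : ℝ) - N * (g₀ / Ng) with hδ₁
  have hδ₀le : |δ₀| ≤ 1 / 2 := by
    rw [hδ₀, hv0, abs_sub_comm]; exact abs_sub_round _
  have hδ₁le : |δ₁| ≤ 1 / 2 := by
    rw [hδ₁, hv1, abs_sub_comm]; exact abs_sub_round _
  -- unit tangent components are `≤ 1`
  have hτ0 : |(-g₁ / Ng)| ≤ 1 := by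
    rw [abs_div, abs_neg, abs_of_pos hN0, div_le_one hN0]
    have hh := abs_le_of_sq_le_sq' (show g₁ ^ 2 ≤ Ng ^ 2 by rw [hNsq]; nlinarith) hN0.le
    exact abs_le.2 ⟨by linarith [hh.1], hh.2⟩
  have hτ1 : |(g₀ / Ng)| ≤ 1 := by
    rw [abs_div, abs_of_pos hN0, div_le_one hN0]
    have hh := abs_le_of_sq_le_sq' (show g₀ ^ 2 ≤ Ng ^ 2 by rw [hNsq]; nlinarith) hN0.le
    exact abs_le.2 ⟨by linarith [hh.1], hh.2⟩
  refine ⟨?_, ?_, ?_⟩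
  · -- tangency
    have hlin : fderiv ℝ e pF (fun j => hx * (v j : ℝ)) = hx * (δ₀ * g₀ + δ₁ * g₁) := by
      rw [fderiv_apply_eq_grad e pF]
      simp only [← hg₀, ← hg₁]
      have : (v 0 : ℝ) * g₀ + (v 1 : ℝ) * g₁ = δ₀ * g₀ + δ₁ * g₁ := by
        rw [hδ₀, hδ₁]; field_simp; ring
      calc hx * (v 0 : ℝ) * g₀ + hx * (v 1 : ℝ) * g₁ = hx * ((v 0 : ℝ) * g₀ + (v 1 : ℝ) * g₁) := by ring
        _ = hx * (δ₀ * g₀ + δ₁ * g₁) := by rw [this]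
    rw [hlin, abs_mul]
    refine mul_le_mul_of_nonneg_left ?_ (abs_nonneg _)
    calc |δ₀ * g₀ + δ₁ * g₁| ≤ |δ₀ * g₀| + |δ₁ * g₁| := abs_add_le _ _
      _ = |δ₀| * |g₀| + |δ₁| * |g₁| := by rw [abs_mul, abs_mul]
      _ ≤ 1 / 2 * G₁ + 1 / 2 * G₁ := add_le_add (mul_le_mul hδ₀le (hgi 0) (abs_nonneg _) (by norm_num))
          (mul_le_mul hδ₁le (hgi 1) (abs_nonneg _) (by norm_num))
      _ = G₁ := by ring
  · -- size
    intro j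
    have hN' : 0 ≤ N := by linarith
    fin_cases j
    · have : (v 0 : ℝ) = N * (-g₁ / Ng) + δ₀ := by rw [hδ₀]; ring
      simp only [Fin.zero_eta, Fin.isValue]
      rw [this]
      calc _ ≤ |N * (-g₁ / Ng)| + |δ₀| := abs_add_le _ _
        _ ≤ N * 1 + 1 / 2 := add_le_add (by rw [abs_mul, abs_of_nonneg hN']; exact mul_le_mul_of_nonneg_left hτ0 hN') hδ₀le
        _ = N + 1 / 2 := by ring
    · have : (v 1 : ℝ) = N * (g₀ / Ng) + δ₁ := by rw [hδ₁]; ring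
      simp only [Fin.mk_one, Fin.isValue]
      rw [this]
      calc _ ≤ |N * (g₀ / Ng)| + |δ₁| := abs_add_le _ _
        _ ≤ N * 1 + 1 / 2 := add_le_add (by rw [abs_mul, abs_of_nonneg hN']; exact mul_le_mul_of_nonneg_left hτ1 hN') hδ₁le
        _ = N + 1 / 2 := by ring
  · -- nonzero: one tangent component is `≥ 1/√2` in size, so its rounding is nonzero
    intro hv
    have hv0' : (v 0 : ℝ) = 0 := by rw [hv]; simp
    have hv1' : (v 1 : ℝ) = 0 := by rw [hv]; simp
    have e0 : N * (-g₁ / Ng) = -δ₀ := by rw [hδ₀, hv0']; ring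
    have e1 : N * (g₀ / Ng) = -δ₁ := by rw [hδ₁, hv1']; ring
    have hs : (N * (-g₁ / Ng)) ^ 2 + (N * (g₀ / Ng)) ^ 2 = N ^ 2 := by
      field_simp
      rw [hNsq]; ring
    have h1 : (N * (-g₁ / Ng)) ^ 2 ≤ 1 / 4 := by
      rw [e0, neg_sq, ← sq_abs]; nlinarith [abs_nonneg δ₀]
    have h2 : (N * (g₀ / Ng)) ^ 2 ≤ 1 / 4 := by
      rw [e1, neg_sq, ← sq_abs]; nlinarith [abs_nonneg δ₁]
    nlinarith

end Summit.HubbardSuperconductivity.HubbardSuperconductivity.Theorems.TorusFourierL2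

end
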